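import Mathlib.Analysis.Normed.Unbundled.SpectralNorm
import Mathlib.Analysis.Normed.Module.FiniteDimension
import Mathlib.NumberTheory.Padics.ProperSpace
import Literature.AnabelianGeometry.AbsoluteAnabelian.AbsTopIII.KummerFaithful
import HarnessLib

/-!
# [AbsTopIII] Remark 1.5.4 (i), torus part over the base: finite extensions of `ℚ_p` are torally
# Kummer-faithful

Proof-only companion (no new definitions) to `AbsTopIII/KummerFaithful.lean`
(S. Mochizuki, *Topics in Absolute Anabelian Geometry III*, §1, Def. 1.5 and Rmk. 1.5.4 (i),
manuscript pp. 32–33, lit key `paper:url-5493eb38cbb7`).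

Rmk. 1.5.4 (i) p. 33: "every sub-`p`-adic field `k` [...] is Kummer-faithful [...] one reduces
[...] to the case where `k` itself is an MLF.  On the other hand, if `k`, hence also `k_H`, is a
finite extension of `ℚ_p`, then `A(k_H)` is an extension of a finitely generated `ℤ`-module by a
compact abelian `p`-adic Lie group [...]. In particular, the condition of Definition 1.5, (a), is
satisfied."

This file kernel-checks the TORUS case (`A = 𝔾_m`) of that last step, i.e. the content of
`IsTorallyKummerFaithful` (Def. 1.5, "respectively, every torus") for MLF's:

* `divisibleElementsTrivial_units_of_finite_padic` : for a finite extension `F` of `ℚ_[p]`,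
  `⋂_N (F^×)^N = {1}` (`DivisibleElementsTrivial Fˣ`);
* `isTorallyKummerFaithful_padic`, `isTorallyKummerFaithful_of_finite_padic` : `ℚ_p` and every
  finite extension of `ℚ_p` (every MLF) are torally Kummer-faithful.

Method (classical; the "compact `p`-adic Lie group" sentence made elementary).  Equip `F` with the
spectral norm extending `‖·‖_p` (Mathlib `spectralNorm.normedField`, multiplicative and
nonarchimedean since `ℚ_p` is complete).  (1) The value group is discrete: by
`spectralNorm_eq_norm_coeff_zero_rpow`, `‖z‖^{[F:ℚ_p]!} ∈ p^ℤ` for `z ≠ 0`, so an element with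
`N`-th roots for every `N` has norm `1`.  (2) `F` is a finite-dimensional normed `ℚ_p`-space, hence
proper; the unit sphere `S` is compact, so for `ε > 0` it is covered by finitely many (say `K`)
balls of radius `ε`; by pigeonhole among `y⁰, …, y^K` (`y ∈ S`) two powers are `ε`-close, whence
`‖y^m − 1‖ < ε` for some `1 ≤ m ≤ K`, and then `‖y^{K!} − 1‖ < ε` (ultrametric estimate
`‖wⁿ − 1‖ ≤ ‖w − 1‖` for `‖w‖ ≤ 1`).  (3) If `x ∈ S` is infinitely divisible, `x = y^{K!}` with
`y ∈ S`, so `‖x − 1‖ < ε` for every `ε`, i.e. `x = 1`.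

HONEST FRAMING: a classical fact about `p`-adic fields quoted (with proof sketch) by a refereed
paper; nothing here bears on [IUTchIII] Cor. 3.12.  The abelian-variety clause of Rmk. 1.5.4 (i)
(Mattuck's structure theorem for `A(K)`) is NOT addressed here.
-/

noncomputable section

open scoped Classical

namespace Literature.AnabelianGeometry.AbsoluteAnabelian.AbsTopIII

section PadicFiniteExtension

variable (p : ℕ) [Fact p.Prime] (F : Type*) [Field F] [Algebra ℚ_[p] F] [FiniteDimensional ℚ_[p] F]

include p

/-- Discreteness of the value group of the spectral norm on a finite extension `F/ℚ_p`: for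
`z ≠ 0`, `‖z‖_sp ^ ([F:ℚ_p]!) = p^m` for some integer `m` (from
`‖z‖_sp = ‖a₀‖_p^{1/deg}`, `a₀` the constant coefficient of the minimal polynomial).
[cite: MochizukiAbsTopIII2015, Rmk 1.5.4 (i) p.33] -/
private theorem spectralNorm_pow_factorial_eq_zpow (z : F) (hz : z ≠ 0) :
    ∃ m : ℤ, spectralNorm ℚ_[p] F z ^ (Module.finrank ℚ_[p] F).factorial = (p : ℝ) ^ m := by
  haveI : Algebra.IsAlgebraic ℚ_[p] F := Algebra.IsAlgebraic.of_finite ℚ_[p] F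
  have hint : IsIntegral ℚ_[p] z := Algebra.IsIntegral.isIntegral z
  have hdpos : 0 < (minpoly ℚ_[p] z).natDegree := minpoly.natDegree_pos hint
  have hdle : (minpoly ℚ_[p] z).natDegree ≤ Module.finrank ℚ_[p] F := minpoly.natDegree_le z
  obtain ⟨q, hq⟩ := Nat.dvd_factorial hdpos hdle
  have ha0 : (minpoly ℚ_[p] z).coeff 0 ≠ 0 := minpoly.coeff_zero_ne_zero hint hz
  have hnorm : spectralNorm ℚ_[p] F z ^ (minpoly ℚ_[p] z).natDegree =
      ‖(minpoly ℚ_[p] z).coeff 0‖ := by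
    rw [spectralNorm.spectralNorm_eq_norm_coeff_zero_rpow ℚ_[p] F z, one_div,
      Real.rpow_inv_natCast_pow (norm_nonneg _) hdpos.ne']
  refine ⟨-((minpoly ℚ_[p] z).coeff 0).valuation * q, ?_⟩
  rw [hq, pow_mul, hnorm, Padic.norm_eq_zpow_neg_valuation ha0, ← zpow_natCast, ← zpow_mul]

/-- Step (1): an infinitely divisible nonzero element of a finite extension of `ℚ_p` has spectral
norm `1`. [cite: MochizukiAbsTopIII2015, Rmk 1.5.4 (i) p.33] -/
private theorem spectralNorm_eq_one_of_forall_exists_pow_eq (x : F) (hx : x ≠ 0)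
    (hdiv : ∀ n : ℕ, 0 < n → ∃ y : F, y ^ n = x) : spectralNorm ℚ_[p] F x = 1 := by
  haveI : Algebra.IsAlgebraic ℚ_[p] F := Algebra.IsAlgebraic.of_finite ℚ_[p] F
  have hD : (Module.finrank ℚ_[p] F).factorial ≠ 0 := Nat.factorial_ne_zero _
  obtain ⟨m, hm⟩ := spectralNorm_pow_factorial_eq_zpow p F x hx
  have hp1 : (1 : ℝ) < p := by exact_mod_cast (Fact.out : p.Prime).one_lt
  have hp0 : (0 : ℝ) < p := lt_trans zero_lt_one hp1
  -- every positive integer divides `m`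
  have hdvd : ∀ N : ℕ, 0 < N → (N : ℤ) ∣ m := by
    intro N hN
    obtain ⟨y, hy⟩ := hdiv N hN
    have hy0 : y ≠ 0 := by
      rintro rfl
      rw [zero_pow hN.ne'] at hy
      exact hx hy.symm
    obtain ⟨m', hm'⟩ := spectralNorm_pow_factorial_eq_zpow p F y hy0
    have key : (p : ℝ) ^ m = (p : ℝ) ^ (m' * N) := by
      rw [← hm, ← hy, isPowMul_spectralNorm y hN, ← pow_mul, mul_comm N, pow_mul, hm',
        ← zpow_natCast, ← zpow_mul]
    exact ⟨m', by rw [zpow_right_injective₀ hp0 hp1.ne' key, mul_comm]⟩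
  have hm0 : m = 0 := by
    refine Int.eq_zero_of_dvd_of_natAbs_lt_natAbs (hdvd (m.natAbs + 1) (Nat.succ_pos _)) ?_
    rw [Int.natAbs_natCast]
    exact Nat.lt_succ_self _
  rw [hm0, zpow_zero] at hm
  exact (pow_left_inj₀ (spectralNorm_nonneg x) zero_le_one hD).mp (by rw [hm, one_pow])

/-- Ultrametric estimate: `‖wⁿ − 1‖ ≤ ‖w − 1‖` whenever `‖w‖ ≤ 1` (spectral norm on `F`).
[cite: MochizukiAbsTopIII2015, Rmk 1.5.4 (i) p.33] -/
private theorem spectralNorm_pow_sub_one_le (w : F) (hw : spectralNorm ℚ_[p] F w ≤ 1) (n : ℕ) :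
    spectralNorm ℚ_[p] F (w ^ n - 1) ≤ spectralNorm ℚ_[p] F (w - 1) := by
  haveI : Algebra.IsAlgebraic ℚ_[p] F := Algebra.IsAlgebraic.of_finite ℚ_[p] F
  letI : NormedField F := spectralNorm.normedField ℚ_[p] F
  have hnorm : ∀ z : F, ‖z‖ = spectralNorm ℚ_[p] F z := fun _ => rfl
  haveI : IsUltrametricDist F :=
    IsUltrametricDist.isUltrametricDist_of_forall_norm_add_le_max_norm
      (fun a b => isNonarchimedean_spectralNorm a b)
  simp only [← hnorm] at hw ⊢
  induction n with
  | zero => simp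
  | succ n ih =>
    have hsplit : w ^ (n + 1) - 1 = w * (w ^ n - 1) + (w - 1) := by ring
    rw [hsplit]
    refine (IsUltrametricDist.norm_add_le_max _ _).trans (max_le ?_ le_rfl)
    rw [norm_mul]
    calc ‖w‖ * ‖w ^ n - 1‖ ≤ 1 * ‖w - 1‖ := by gcongr
      _ = ‖w - 1‖ := one_mul _

/-- Step (2): for every `ε > 0` there is `M ≥ 1` with `‖y^M − 1‖ < ε` for all `y` of spectral norm
`1` (compactness of the unit sphere of the finite-dimensional `ℚ_p`-space `F` + pigeonhole).
[cite: MochizukiAbsTopIII2015, Rmk 1.5.4 (i) p.33] -/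
private theorem exists_forall_spectralNorm_pow_sub_one_lt {ε : ℝ} (hε : 0 < ε) :
    ∃ M : ℕ, 0 < M ∧ ∀ y : F, spectralNorm ℚ_[p] F y = 1 →
      spectralNorm ℚ_[p] F (y ^ M - 1) < ε := by
  haveI : Algebra.IsAlgebraic ℚ_[p] F := Algebra.IsAlgebraic.of_finite ℚ_[p] F
  letI : NormedField F := spectralNorm.normedField ℚ_[p] F
  letI : NormedSpace ℚ_[p] F := spectralNorm.normedSpace ℚ_[p] F
  haveI : ProperSpace F := FiniteDimensional.proper ℚ_[p] F
  have hnorm : ∀ z : F, ‖z‖ = spectralNorm ℚ_[p] F z := fun _ => rfl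
  haveI : IsUltrametricDist F :=
    IsUltrametricDist.isUltrametricDist_of_forall_norm_add_le_max_norm
      (fun a b => isNonarchimedean_spectralNorm a b)
  -- finitely many `ε`-balls cover the (compact) unit sphere
  obtain ⟨t, -, htfin, hcover⟩ :=
    finite_cover_balls_of_compact (isCompact_sphere (0 : F) 1) hε
  set K : ℕ := htfin.toFinset.card with hK
  -- every norm-one `y` has a power `y^m`, `1 ≤ m ≤ K`, that is `ε`-close to `1`
  have hstep : ∀ y : F, ‖y‖ = 1 → ∃ m : ℕ, 0 < m ∧ m ≤ K ∧ ‖y ^ m - 1‖ < ε := by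
    intro y hy
    have hmem : ∀ i : ℕ, y ^ i ∈ Metric.sphere (0 : F) 1 := fun i => by
      rw [mem_sphere_zero_iff_norm, norm_pow, hy, one_pow]
    have hc : ∀ i : ℕ, ∃ c ∈ t, y ^ i ∈ Metric.ball c ε := fun i => by
      simpa only [Set.mem_iUnion, exists_prop] using hcover (hmem i)
    choose c hct hcy using hc
    obtain ⟨i, hi, j, hj, hij, hcij⟩ := Finset.exists_ne_map_eq_of_card_lt_of_maps_to
      (s := Finset.range (K + 1)) (t := htfin.toFinset) (f := c)
      (by rw [← hK, Finset.card_range]; exact Nat.lt_succ_self K)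
      (fun a _ => htfin.mem_toFinset.mpr (hct a))
    -- two distinct powers lie in the same ball, hence are `ε`-close
    have hclose : ∀ {a b : ℕ}, a < b → b ≤ K → c a = c b → ∃ m : ℕ, 0 < m ∧ m ≤ K ∧
        ‖y ^ m - 1‖ < ε := by
      intro a b hab hbK hcab
      refine ⟨b - a, Nat.sub_pos_of_lt hab, (Nat.sub_le b a).trans hbK, ?_⟩
      have hdist : dist (y ^ b) (y ^ a) < ε := by
        refine (IsUltrametricDist.dist_triangle_max (y ^ b) (c a) (y ^ a)).trans_lt (max_lt ?_ ?_)
        · rw [hcab]; exact Metric.mem_ball.mp (hcy b)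
        · rw [dist_comm]; exact Metric.mem_ball.mp (hcy a)
      have hfac : y ^ b - y ^ a = y ^ a * (y ^ (b - a) - 1) := by
        rw [mul_sub, mul_one, ← pow_add, Nat.add_sub_cancel' hab.le]
      rw [dist_eq_norm, hfac, norm_mul, norm_pow, hy, one_pow, one_mul] at hdist
      exact hdist
    have hiK : i ≤ K := Nat.lt_succ_iff.mp (Finset.mem_range.mp hi)
    have hjK : j ≤ K := Nat.lt_succ_iff.mp (Finset.mem_range.mp hj)
    rcases lt_or_gt_of_ne hij with h | h
    · exact hclose h hjK hcij
    · exact hclose h hiK hcij.symm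
  refine ⟨K.factorial, Nat.factorial_pos K, fun y hy => ?_⟩
  rw [← hnorm] at hy ⊢
  obtain ⟨m, hm0, hmK, hmε⟩ := hstep y hy
  obtain ⟨q, hq⟩ := Nat.dvd_factorial hm0 hmK
  rw [hq, pow_mul]
  have hle := spectralNorm_pow_sub_one_le p F (y ^ m)
    (by rw [← hnorm, norm_pow, hy, one_pow]) q
  simp only [← hnorm] at hle
  exact hle.trans_lt hmε

/-- The torus case of [AbsTopIII] Rmk. 1.5.4 (i) over an MLF: for a finite extension `F` of `ℚ_p`,
`⋂_{N ≥ 1} (F^×)^N = {1}` — condition (a) of Def. 1.5 p. 32 for `𝔾_m` over `F` ("if `k` [...] is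
a finite extension of `ℚ_p`, then `A(k_H)` is an extension of a finitely generated `ℤ`-module by a
compact abelian `p`-adic Lie group [...] In particular, the condition of Definition 1.5, (a), is
satisfied", p. 33). [cite: MochizukiAbsTopIII2015, Rmk 1.5.4 (i) p.33] -/
theorem divisibleElementsTrivial_units_of_finite_padic : DivisibleElementsTrivial Fˣ := by
  haveI : Algebra.IsAlgebraic ℚ_[p] F := Algebra.IsAlgebraic.of_finite ℚ_[p] F
  refine ⟨fun x hx => ?_⟩
  have hx0 : (x : F) ≠ 0 := x.ne_zero
  have hdiv : ∀ n : ℕ, 0 < n → ∃ y : F, y ^ n = (x : F) := fun n hn => by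
    obtain ⟨y, hy⟩ := hx n hn
    exact ⟨y, by rw [← Units.val_pow_eq_pow_val, hy]⟩
  have h1 : spectralNorm ℚ_[p] F x = 1 :=
    spectralNorm_eq_one_of_forall_exists_pow_eq p F x hx0 hdiv
  have h2 : ∀ ε : ℝ, 0 < ε → spectralNorm ℚ_[p] F ((x : F) - 1) < ε := by
    intro ε hε
    obtain ⟨M, hM, hMε⟩ := exists_forall_spectralNorm_pow_sub_one_lt p F hε
    obtain ⟨y, hy⟩ := hdiv M hM
    have hy1 : spectralNorm ℚ_[p] F y = 1 := by
      have hpow : spectralNorm ℚ_[p] F y ^ M = 1 := by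
        rw [← isPowMul_spectralNorm y hM, hy, h1]
      exact (pow_left_inj₀ (spectralNorm_nonneg y) zero_le_one hM.ne').mp
        (by rw [hpow, one_pow])
    rw [← hy]
    exact hMε y hy1
  have h3 : spectralNorm ℚ_[p] F ((x : F) - 1) = 0 := by
    by_contra h
    have hpos : 0 < spectralNorm ℚ_[p] F ((x : F) - 1) :=
      lt_of_le_of_ne (spectralNorm_nonneg _) (Ne.symm h)
    exact lt_irrefl _ (h2 _ hpos)
  have h4 : (x : F) - 1 = 0 :=
    eq_zero_of_map_spectralNorm_eq_zero h3 (Algebra.IsAlgebraic.isAlgebraic _)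
  exact Units.val_eq_one.mp (sub_eq_zero.mp h4)

/-- `ℚ_p` is torally Kummer-faithful ([AbsTopIII] Def. 1.5 p. 32, torus case of Rmk. 1.5.4 (i)
p. 33 for the base field: every finite extension `k'/ℚ_p` satisfies `⋂_N (k'^×)^N = {1}`).
[cite: MochizukiAbsTopIII2015, Rmk 1.5.4 (i) p.33] -/
theorem isTorallyKummerFaithful_padic : IsTorallyKummerFaithful ℚ_[p] :=
  ⟨inferInstance, fun k' _ _ hfin => by
    haveI := hfin
    exact divisibleElementsTrivial_units_of_finite_padic p k'⟩

/-- Every finite extension `F` of `ℚ_p` — every MLF — is torally Kummer-faithful ([AbsTopIII]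
Rmk. 1.5.4 (i) p. 33, torus case: a finite extension of `F` is again a finite extension of `ℚ_p`).
[cite: MochizukiAbsTopIII2015, Rmk 1.5.4 (i) p.33] -/
theorem isTorallyKummerFaithful_of_finite_padic : IsTorallyKummerFaithful F := by
  haveI : CharZero F := charZero_of_injective_algebraMap (algebraMap ℚ_[p] F).injective
  refine ⟨inferInstance, fun k' _ _ hfin => ?_⟩
  haveI := hfin
  letI : Algebra ℚ_[p] k' := ((algebraMap F k').comp (algebraMap ℚ_[p] F)).toAlgebra
  haveI : IsScalarTower ℚ_[p] F k' := IsScalarTower.of_algebraMap_eq (fun _ => rfl)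
  haveI : FiniteDimensional ℚ_[p] k' := Module.Finite.trans F k'
  exact divisibleElementsTrivial_units_of_finite_padic p k'

end PadicFiniteExtension

end Literature.AnabelianGeometry.AbsoluteAnabelian.AbsTopIII
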